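import Literature.Probability.LatticeModels.LupuCouplingClusters
import HarnessLib

/-!
# Lupu's coupling in finite volume II: `E[ψ_x ψ_y ; x ↮ y] = 0`

Topic `Literature/Probability/LatticeModels`. Brick 6b of the proof of
`Literature.Probability.LatticeModels.Lupu2016_cableSignClustersBounded` (Lupu 2016, Prop. 5.5).
Fix a finite `Λ ⊆ ℤ^d` (`d ≥ 3`), the finite-volume free field `ψ = ψ^Λ(φ)` (`dirichletField`,
vanishing off `Λ`, innovation property at every `u ∈ Λ`) under the free-field law `ν`, and,
conditionally on `ψ`, the independent bonds with Lupu's symmetric weights `symWeight ψ`.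

* `integral_mul_mul_prodBernoulli_clusterEq` — `E[ψ_x ψ_y · P_ψ(C^Λ_x = S)] = 0` for `x ∈ S ⊆ Λ`,
  `y ∉ S`: flipping `ψ` on `S` preserves the law of `ψ` weighted by `P_ψ(C_x = S)`
  (`integral_comp_setFlip` and `prodBernoulli_real_clusterEq_setFlip_mul_exp`) and reverses the
  sign of `ψ_x ψ_y` — Lupu's "if `x`, `y` are not in the same cluster, `sign φ_x sign φ_y = ±1`
  with probability `½`" (proof of Prop. 5.2), in finite volume where every cluster is finite;
* `integral_mul_mul_prodBernoulli_connWithin` — summing over `S`: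
  **`E[ψ_x ψ_y · P_ψ(x ↔ y in Λ)] = E[ψ_x ψ_y] = G_Λ(x,y)`**, the finite-volume form of
  `E[φ_x φ_y 1_{x↔y}] = G(x,y)`;
* `prodBernoulli_real_connWithin_eq_zero_of_mul_neg` — clusters are sign-monochromatic;
* `integral_abs_mul_mul_prodBernoulli_connWithin_le` — `E[|ψ_x ψ_y| · P_ψ(x ↔ y in Λ')] ≤ G_Λ(x,y)`
  for `Λ' ⊆ Λ`, the input of the two-point bound (`LupuCouplingTwoPoint.lean`).

References: T. Lupu, Ann. Probab. 44 (2016), Thm. 1 bis, Prop. 4.2, Prop. 5.2 [`Lupu2016`].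
-/

noncomputable section

namespace Literature.Probability.LatticeModels

open _root_.MeasureTheory _root_.ProbabilityTheory Finset Filter Literature.Probability.Percolation
open scoped ENNReal NNReal

variable {d : ℕ}

/-! ### The coin identity: `E[ψ_x ψ_y · P_ψ(C_x = S)] = 0` -/

/-- `ψ ↦ P_ψ(A)` is continuous for every cylinder event `A` over the edges of a finite `Λ`.
[folklore] -/
theorem continuous_prodBernoulli_symWeight_real {A : Set (Set (Sym2 (Site d)))}
    {F : Finset (Sym2 (Site d))} (hA : DeterminedBy A (↑F : Set _)) :
    Continuous fun ψ : Site d → ℝ => (prodBernoulli (symWeight ψ)).real A :=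
  continuous_prodBernoulli_real_of_determinedBy (fun ψ => symWeight ψ) hA
    fun e _ => continuous_coe_symWeight e

namespace IsDiscreteGFF

variable {ν : Measure (Site d → ℝ)}

/-- **`E[ψ_x ψ_y · P_ψ(C^Λ_x = S)] = 0`** for `x ∈ S ⊆ Λ`, `y ∉ S` (`d ≥ 3`, `ψ = ψ^Λ` the
finite-volume field under the free-field law): flipping `ψ` on `S` preserves the law of `ψ`
weighted by `P_ψ(C_x = S)` (`integral_comp_setFlip` + `prodBernoulli_real_clusterEq_setFlip_mul_exp`)
and changes the sign of `ψ_x ψ_y`. This is Lupu's symmetry "if `x` and `y` are not in the same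
cluster, `sign(φ_x) sign(φ_y)` is `±1` with probability `½` each" (proof of Prop. 5.2) in finite
volume. [cite: Lupu2016, proof of Prop. 5.2] -/
theorem integral_mul_mul_prodBernoulli_clusterEq (hν : IsDiscreteGFF ν (coordProc d)) (hd : 3 ≤ d)
    {Λ S : Finset (Site d)} {x y : Site d} (hx : x ∈ S) (hS : S ⊆ Λ) (hy : y ∉ S) :
    ∫ φ, dirichletField Λ φ x * dirichletField Λ φ y *
        (prodBernoulli (symWeight (dirichletField Λ φ))).real (clusterEq Λ S x) ∂ν = 0 := by
  set Φ : (Site d → ℝ) → ℝ := fun ψ =>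
    ψ x * ψ y * (prodBernoulli (symWeight ψ)).real (clusterEq Λ S x) with hΦ
  have hΦc : Continuous Φ := ((continuous_apply x).mul (continuous_apply y)).mul
    (continuous_prodBernoulli_symWeight_real (determinedBy_clusterEq Λ S x))
  have hX : ∀ u ∈ S, IsInnovationSite ν (fun z (φ : Site d → ℝ) => dirichletField Λ φ z) u :=
    fun u hu => hν.isInnovationSite_dirichletField hd (hS hu)
  -- flip: `E Φ(ψ) = E (Φ ∘ R_S)(R_S ψ) = E[(Φ ∘ R_S)(ψ) e^{-2 flipExponent}] = -E Φ(ψ)`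
  have hflip := integral_comp_setFlip (P := ν) (by omega) S hX (measurable_dirichletField Λ)
    (F := Φ ∘ setFlip S) ((hΦc.comp (continuous_pi fun z => ?_)).measurable.stronglyMeasurable)
  swap
  · by_cases hz : z ∈ S
    · simp only [setFlip, hz, if_true]; exact (continuous_apply z).neg
    · simp only [setFlip, hz, if_false]; exact continuous_apply z
  have hinv : ∀ ψ : Site d → ℝ, setFlip S (setFlip S ψ) = ψ := fun ψ => by
    funext z; by_cases hz : z ∈ S <;> simp [setFlip, hz]
  simp only [Function.comp_apply, hinv] at hflip
  have hpt : ∀ φ : Site d → ℝ, Φ (setFlip S (dirichletField Λ φ)) *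
      Real.exp (-2 * flipExponent S (dirichletField Λ φ)) = -Φ (dirichletField Λ φ) := by
    intro φ
    simp only [hΦ]
    rw [mul_assoc, prodBernoulli_real_clusterEq_setFlip_mul_exp hx hS
      (fun v hv => dirichletField_of_not_mem φ hv)]
    simp [setFlip, hx, hy]
  simp_rw [hpt, integral_neg] at hflip
  change ∫ φ, Φ (dirichletField Λ φ) ∂ν = 0
  linarith

/-- The events `{C^Λ_x = S}` over the `S` containing `x` and not `y` partition `{x ↮ y in Λ}`.
[folklore] -/
theorem prodBernoulli_real_not_connWithin (p : Sym2 (Site d) → unitInterval) (Λ : Finset (Site d))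
    (x y : Site d) :
    (prodBernoulli p).real (connWithin Λ x y)ᶜ =
      ∑ S ∈ (insert x Λ).powerset.filter (fun S => x ∈ S ∧ y ∉ S),
        (prodBernoulli p).real (clusterEq Λ S x) := by
  classical
  have hset : (connWithin Λ x y)ᶜ =
      ⋃ S ∈ (insert x Λ).powerset.filter (fun S => x ∈ S ∧ y ∉ S), clusterEq Λ S x := by
    ext ω
    simp only [Set.mem_compl_iff, connWithin, Set.mem_setOf_eq, Set.mem_iUnion, Finset.mem_filter,
      Finset.mem_powerset, exists_prop, clusterEq]
    constructor
    · intro hω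
      have hfin : (clusterWithin Λ ω x).Finite :=
        (Λ.finite_toSet.insert x).subset (clusterWithin_subset Λ ω x)
      refine ⟨hfin.toFinset, ⟨⟨?_, ?_, ?_⟩, ?_⟩⟩
      · intro z hz
        rw [Set.Finite.mem_toFinset] at hz
        simpa using clusterWithin_subset Λ ω x hz
      · rw [Set.Finite.mem_toFinset]; exact mem_openCluster_self _ _
      · rw [Set.Finite.mem_toFinset]; exact hω
      · rw [Set.Finite.coe_toFinset]
    · rintro ⟨S, ⟨-, -, hyS⟩, hC⟩ hω
      rw [hC] at hω
      exact hyS hω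
  rw [hset]
  refine measureReal_biUnion_finset (fun S _ T _ hST => ?_)
    fun S _ => (determinedBy_clusterEq Λ S x).measurableSet_of_finset
  rw [Function.onFun, Set.disjoint_left]
  intro ω hS hT
  exact hST (Finset.coe_injective (hS.symm.trans hT))

/-- **`E[ψ_x ψ_y · P_ψ(x ↔ y in Λ)] = G_Λ(x,y)`** (`d ≥ 3`, `x ∈ Λ`): since
`E[ψ_x ψ_y · P_ψ(x ↮ y)] = ∑_S E[ψ_x ψ_y · P_ψ(C_x = S)] = 0` and `E[ψ_x ψ_y] = G_Λ(x,y)`. This is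
the finite-volume form of the identity `E[φ_x φ_y 1_{x↔y}] = G(x,y)` behind Lupu's two-point
function (Prop. 5.2). [cite: Lupu2016, Prop. 5.2] -/
theorem integral_mul_mul_prodBernoulli_connWithin (hν : IsDiscreteGFF ν (coordProc d)) (hd : 3 ≤ d)
    {Λ : Finset (Site d)} {x : Site d} (hx : x ∈ Λ) (y : Site d) :
    ∫ φ, dirichletField Λ φ x * dirichletField Λ φ y *
        (prodBernoulli (symWeight (dirichletField Λ φ))).real (connWithin Λ x y) ∂ν =
      dirichletGreen Λ x y := by
  classical
  set 𝒮 := (insert x Λ).powerset.filter (fun S => x ∈ S ∧ y ∉ S) with h𝒮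
  have hint : Integrable (fun φ : Site d → ℝ => dirichletField Λ φ x * dirichletField Λ φ y) ν :=
    ((hν.isGaussianProcess_dirichletField Λ).hasGaussianLaw_eval x).memLp_two.integrable_mul
      ((hν.isGaussianProcess_dirichletField Λ).hasGaussianLaw_eval y).memLp_two
  have hbdd : ∀ A : Set (Set (Sym2 (Site d))),
      (∃ F : Finset (Sym2 (Site d)), DeterminedBy A (↑F : Set (Sym2 (Site d)))) →
      Integrable (fun φ : Site d → ℝ => dirichletField Λ φ x * dirichletField Λ φ y *
        (prodBernoulli (symWeight (dirichletField Λ φ))).real A) ν := by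
    rintro A ⟨F, hF⟩
    simp_rw [mul_comm _ ((prodBernoulli _).real A)]
    refine hint.bdd_mul (c := 1) ?_ (Eventually.of_forall fun φ => ?_)
    · exact ((continuous_prodBernoulli_symWeight_real hF).measurable.comp
        (measurable_pi_lambda _ (measurable_dirichletField Λ))).aestronglyMeasurable
    · rw [Real.norm_eq_abs, abs_of_nonneg measureReal_nonneg]; exact measureReal_le_one
  -- `P(x ↔ y) = 1 - ∑_S P(C_x = S)`
  have hcompl : ∀ φ : Site d → ℝ,
      (prodBernoulli (symWeight (dirichletField Λ φ))).real (connWithin Λ x y) =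
      1 - ∑ S ∈ 𝒮, (prodBernoulli (symWeight (dirichletField Λ φ))).real (clusterEq Λ S x) := by
    intro φ
    rw [← prodBernoulli_real_not_connWithin, measureReal_compl
      (determinedBy_connWithin Λ x y).measurableSet_of_finset, probReal_univ]
    ring
  simp_rw [hcompl, mul_sub, mul_one, Finset.mul_sum]
  rw [integral_sub hint (integrable_finsetSum _ fun S _ => hbdd _ ⟨_, determinedBy_clusterEq Λ S x⟩),
    integral_finsetSum _ fun S _ => hbdd _ ⟨_, determinedBy_clusterEq Λ S x⟩,
    hν.integral_dirichletField_mul hd]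
  have hzero : ∑ S ∈ 𝒮, ∫ φ, dirichletField Λ φ x * dirichletField Λ φ y *
      (prodBernoulli (symWeight (dirichletField Λ φ))).real (clusterEq Λ S x) ∂ν = 0 := by
    refine Finset.sum_eq_zero fun S hS => ?_
    rw [h𝒮, Finset.mem_filter, Finset.mem_powerset] at hS
    have hSΛ : S ⊆ Λ := fun z hz => by
      rcases Finset.mem_insert.1 (hS.1 hz) with rfl | h
      · exact hx
      · exact h
    exact hν.integral_mul_mul_prodBernoulli_clusterEq hd hS.2.1 hSΛ hS.2.2
  rw [hzero, sub_zero]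

/-! ### Monochromatic clusters and the monotone consequence -/

/-- **Clusters are sign-monochromatic**: if `ψ_x ψ_y < 0` then `P_ψ(x ↔ y in Λ) = 0` (an open
path from `x` to `y` would use an edge between endpoints of opposite signs, which has weight
`0`). [cite: Lupu2016, Thm. 1 bis] -/
theorem prodBernoulli_real_connWithin_eq_zero_of_mul_neg (Λ : Finset (Site d)) {ψ : Site d → ℝ}
    {x y : Site d} (h : ψ x * ψ y < 0) :
    (prodBernoulli (symWeight ψ)).real (connWithin Λ x y) = 0 := by
  classical
  set Z := (edgesIn (zdGraph d) Λ).filter (fun e => symWeight ψ e = 0) with hZ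
  have hsub : connWithin Λ x y ⊆ ⋃ e ∈ Z, {ω : Set (Sym2 (Site d)) | e ∈ ω} := by
    intro ω hω
    obtain ⟨p⟩ := (show (openGraph _).Reachable x y from hω)
    have hxT : x ∈ {v : Site d | 0 < ψ x * ψ v} := by
      change 0 < ψ x * ψ x
      have : ψ x ≠ 0 := fun h0 => by rw [h0, zero_mul] at h; exact lt_irrefl _ h
      exact mul_self_pos.2 this
    have hyT : y ∉ {v : Site d | 0 < ψ x * ψ v} := fun hy => lt_asymm h hy
    obtain ⟨e, -, ha, hb⟩ := p.exists_boundary_dart _ hxT hyT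
    have hadj := e.adj
    rw [openGraph_adj] at hadj
    simp only [Set.mem_setOf_eq, not_lt] at ha hb
    have hab : ψ e.fst * ψ e.snd ≤ 0 := by
      by_contra hpos
      push Not at hpos
      have key : (ψ x * ψ e.fst) * (ψ e.fst * ψ e.snd) =
          (ψ x * ψ e.snd) * (ψ e.fst * ψ e.fst) := by ring
      have h4 := mul_pos ha hpos
      rw [key] at h4
      have h5 : (ψ x * ψ e.snd) * (ψ e.fst * ψ e.fst) ≤ 0 :=
        mul_nonpos_iff.2 (Or.inr ⟨hb, mul_self_nonneg _⟩)
      linarith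
    refine Set.mem_biUnion (x := s(e.fst, e.snd)) (Finset.mem_coe.2 ?_) hadj.1.1
    rw [hZ, Finset.mem_filter]
    exact ⟨Finset.mem_coe.1 hadj.1.2, symWeight_eq_zero_of_mul_nonpos ψ hab⟩
  refine le_antisymm ?_ measureReal_nonneg
  calc (prodBernoulli (symWeight ψ)).real (connWithin Λ x y)
      ≤ (prodBernoulli (symWeight ψ)).real (⋃ e ∈ Z, {ω : Set (Sym2 (Site d)) | e ∈ ω}) :=
        measureReal_mono hsub (measure_ne_top _ _)
    _ ≤ ∑ e ∈ Z, (prodBernoulli (symWeight ψ)).real {ω : Set (Sym2 (Site d)) | e ∈ ω} :=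
        measureReal_biUnion_finset_le Z _
    _ = 0 := Finset.sum_eq_zero fun e he => by
        rw [prodBernoulli_real_setOf_mem, (Finset.mem_filter.1 he).2]; rfl

/-- **`E[|ψ_x ψ_y| · P_ψ(x ↔ y in Λ')] ≤ G_Λ(x,y)`** for `Λ' ⊆ Λ`, `x ∈ Λ` (`d ≥ 3`): the input of
the two-point bound. Pointwise `|ψ_x ψ_y| P_ψ(x ↔ y in Λ') ≤ ψ_x ψ_y P_ψ(x ↔ y in Λ)` (monotone in
`Λ'`; both sides vanish when `ψ_x ψ_y < 0` by monochromaticity), then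
`integral_mul_mul_prodBernoulli_connWithin`. [cite: Lupu2016, Prop. 5.2] -/
theorem integral_abs_mul_mul_prodBernoulli_connWithin_le (hν : IsDiscreteGFF ν (coordProc d))
    (hd : 3 ≤ d) {Λ Λ' : Finset (Site d)} (hΛ : Λ' ⊆ Λ) {x : Site d} (hx : x ∈ Λ) (y : Site d) :
    ∫ φ, |dirichletField Λ φ x * dirichletField Λ φ y| *
        (prodBernoulli (symWeight (dirichletField Λ φ))).real (connWithin Λ' x y) ∂ν ≤
      dirichletGreen Λ x y := by
  rw [← hν.integral_mul_mul_prodBernoulli_connWithin hd hx y]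
  have hint : Integrable (fun φ : Site d → ℝ => dirichletField Λ φ x * dirichletField Λ φ y) ν :=
    ((hν.isGaussianProcess_dirichletField Λ).hasGaussianLaw_eval x).memLp_two.integrable_mul
      ((hν.isGaussianProcess_dirichletField Λ).hasGaussianLaw_eval y).memLp_two
  have hbdd : ∀ Λ'' : Finset (Site d), Integrable (fun φ : Site d → ℝ =>
      dirichletField Λ φ x * dirichletField Λ φ y *
        (prodBernoulli (symWeight (dirichletField Λ φ))).real (connWithin Λ'' x y)) ν := by
    intro Λ''
    simp_rw [mul_comm _ ((prodBernoulli _).real _)]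
    refine hint.bdd_mul (c := 1) ?_ (Eventually.of_forall fun φ => ?_)
    · exact ((continuous_prodBernoulli_symWeight_real (determinedBy_connWithin Λ'' x y)).measurable.comp
        (measurable_pi_lambda _ (measurable_dirichletField Λ))).aestronglyMeasurable
    · rw [Real.norm_eq_abs, abs_of_nonneg measureReal_nonneg]; exact measureReal_le_one
  refine integral_mono ?_ (hbdd Λ) fun φ => ?_
  · have := (hbdd Λ').abs
    refine this.congr (Eventually.of_forall fun φ => ?_)
    simp only [abs_mul, abs_of_nonneg measureReal_nonneg]
  · dsimp only
    set ψ := dirichletField Λ φ with hψ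
    have hmono : (prodBernoulli (symWeight ψ)).real (connWithin Λ' x y) ≤
        (prodBernoulli (symWeight ψ)).real (connWithin Λ x y) :=
      measureReal_mono fun ω hω => clusterWithin_mono hΛ ω x hω
    rcases le_or_gt 0 (ψ x * ψ y) with hpos | hneg
    · rw [abs_of_nonneg hpos]
      exact mul_le_mul_of_nonneg_left hmono hpos
    · rw [prodBernoulli_real_connWithin_eq_zero_of_mul_neg Λ hneg, mul_zero]
      have h0 : (prodBernoulli (symWeight ψ)).real (connWithin Λ' x y) = 0 :=
        le_antisymm (hmono.trans (prodBernoulli_real_connWithin_eq_zero_of_mul_neg Λ hneg).le)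
          measureReal_nonneg
      rw [h0, mul_zero]

end IsDiscreteGFF

end Literature.Probability.LatticeModels
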